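import Summits.FinalStateConjecture.FinalStateConjecture.Theorems.BartnikGapSettlingGapExhaustionPhotonShellNodeDefs
import Summits.FinalStateConjecture.FinalStateConjecture.Theorems.BartnikGapSettlingGapExhaustionOpenSubsetChronologicalPast
import Summits.FinalStateConjecture.FinalStateConjecture.Theorems.BartnikGapSettlingGapExhaustionContMDiffOnPushforwardField
import Summits.FinalStateConjecture.FinalStateConjecture.Theorems.BartnikGapSettlingGapExhaustionKillingPushforwardAt
import Summits.FinalStateConjecture.FinalStateConjecture.Theorems.BartnikGapSettlingGapExhaustionRicAtChartKillingLocality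
import Summits.FinalStateConjecture.FinalStateConjecture.Theorems.BartnikGapSettlingGapExhaustionContDiffOnPullbackField
import HarnessLib

/-!
# Crux `GapExhaustion` (stmt-FinalStateConjecture-10808), line `photon-shell-pseudoconvexity`:
# stub ConditionalExtensionFar, COMPANION (tail) — chart-level glue, pushforward and Hawking-pair
# bookkeeping of S6b‴-far over the landed node vocabulary `Theorems.PhotonShellNode`

Route `BartnikGapSettling`; helper (`--supports stmt-FinalStateConjecture-10808`) of line lead
c13 (wave-1). Ported VERBATIM from the kernel-checked crux skeleton
`Cruxes/GapExhaustion/Lines/photon_shell_pseudoconvexity.lean` (rev c13), §3e: the gluing lemma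
`coordField_glue` (two chart vector fields agreeing on the overlap of two open sets) and the
manifold-level TAIL of `conditionalExtensionKStationaryFar_of_IKC` as an explicitly stated theorem
`hawkingPair_of_sweptFarChartFields`: given the swept chart Killing field `kf` on `D ∩ {r < c₁}`
(agreeing with the pulled-back Hawking field below `c₀ = r_ph⁺ − ε`) and the far chart Killing
field `kF` on `{r > C M / 2}` (agreeing with `kf` on the collar `{C M / 2 < r < C M}`), glue them
in the chart, push forward to `Φ '' Wg` (bricks N-5 `Theorems.stub_contMDiffOn_pushforwardField`,
N-5b `Theorems.stub_killing_pushforward_at`), patch with `K` on the near collar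
`U' = {M < r < r₊ + 3ε/4}` (`Theorems.killingLoc_isKillingFieldOn_congr/union`) and read off the
Hawking pair `(K', V ∩ Φ '' U')`, Killing on `V' ∪ docOfChart`; far chart points lie in `docOf`
because the far zone is open (`Theorems.stub_subset_chronologicalPast_of_isOpen`, F4). The main
file `…ConditionalExtensionFar.lean` (constants phase, conditional sweep, far chain) imports this.
[cite: IonescuKlainerman2015, Thm 2.4]
-/

noncomputable section

set_option maxSynthPendingDepth 3

-- D-0017: single-problem summit, `Summit.<S>.<S>.…` by design (cf. lakefile `weak.linter.dupNamespace`).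
set_option linter.dupNamespace false

namespace Summit.FinalStateConjecture.FinalStateConjecture.Theorems.PhotonShellNode

open Literature.Geometry.Lorentzian
open Set Filter
open scoped Manifold ContDiff Topology ENNReal

/-- **Gluing two chart vector fields that agree on the overlap of two open sets (rev c13).** The
glued field is eventually equal to the first near every point of `s₁` and to the second near
every point of `s₂`; smoothness, the coordinate Killing equation and `∂₀`-invariance transfer
through these eventual equalities. [folklore] -/
theorem coordField_glue : ∀ (s₁ s₂ : Set E4) (k₁ k₂ : E4 → E4), IsOpen s₁ → IsOpen s₂ →
    Set.EqOn k₁ k₂ (s₁ ∩ s₂) →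
    ∃ k : E4 → E4, (∀ y ∈ s₁, k =ᶠ[nhds y] k₁) ∧ (∀ y ∈ s₂, k =ᶠ[nhds y] k₂) := by
  classical
  intro s₁ s₂ k₁ k₂ hs₁ hs₂ hagree
  refine ⟨fun y => if y ∈ s₁ then k₁ y else k₂ y, fun y hy ↦ ?_, fun y hy ↦ ?_⟩
  · filter_upwards [hs₁.mem_nhds hy] with z hz
    simp only [hz, if_true]
  · filter_upwards [hs₂.mem_nhds hy] with z hz
    by_cases h : z ∈ s₁
    · simp only [h, if_true]; exact hagree ⟨h, hz⟩
    · simp only [h, if_false]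

/-- **The manifold-level tail of S6b‴-far (rev c13, skeleton §3e `conditionalExtensionKStationaryFar_of_IKC`):
chart-level glue, pushforward N-5 and Hawking-pair bookkeeping.** In the package chart `Φ` of an
eternal near-Kerr star chart `Ψ` (smooth, injective, with injective differential on `W = {r > M}`),
let `kf` be the swept chart Killing field on `D ∩ {r < c₁}` agreeing with the pulled-back Hawking
field `dΦ⁻¹ K ∘ Φ` on `D ∩ {r < c₀}`, `c₀ = r_ph⁺ − ε`, and `kF` the far chart Killing field on
`{r > C M / 2}` agreeing with `kf` on the collar `{C M / 2 < r < C M}` (`C ≥ 16`, `C M < c₁`). Then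
the glue `coordField_glue` of `kf` (below `C M`) with `kF` (beyond `C M / 2`), pushed forward to
`Φ '' Wg`, `Wg = (D ∩ {r < C M}) ∪ {r > C M / 2}`, and patched with `K` off `Φ '' Wg`, is a Hawking
pair `(K', V ∩ Φ '' U')`, `U' = {M < r < r₊ + 3ε/4}`, Killing on `V' ∪ docOfChart`: a point of
`docOfChart = docOf ∩ range Ψ` is either a swept/far chart point or lies in the near collar below
`c₀`, where `K` is Killing by hypothesis; far chart points are in `docOf` because the far zone is
open (F4). [cite: IonescuKlainerman2015, Thm 2.4] -/
theorem hawkingPair_of_sweptFarChartFields :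
    ∀ (𝓢 : Spacetime.{0} 4) [𝓢.metric.HasLeviCivita] (M a ε C c₀ c₁ R : ℝ)
      (Ψ : (starBG M a).domain → 𝓢.carrier) (Φ : E4 → 𝓢.carrier) (W D : Set E4)
      (K : Π x : 𝓢.carrier, TangentSpace (𝓡 4) x) (V : Set 𝓢.carrier) (kf kF : E4 → E4),
      0 < M → 0 < ε → ε ≤ M → Kerr.rPlus M a ≤ 2 * M → 16 * M ≤ C * M → 3 * M ≤ R →
      c₀ = rPhPlus M a - ε → Kerr.rPlus M a + ε ≤ c₀ → c₀ < C * M → C * M < c₁ →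
      W = {z | M < Kerr.radius a z} →
      D = {y | Kerr.rPlus M a + ε / 2 < Kerr.radius a y ∧ Kerr.radius a y < c₁ + 1} →
      IsOpen D → D ⊆ W →
      (∀ x : (starBG M a).domain, Φ x.1 = Ψ x) →
      {z : E4 | M < Kerr.radius a z} = ((starBG M a).domain : Set E4) →
      Topology.IsOpenEmbedding Ψ →
      ContMDiffOn 𝓘(ℝ, E4) (𝓡 4) ∞ Φ W →
      (∀ y ∈ W, Function.Injective (mfderiv 𝓘(ℝ, E4) (𝓡 4) Φ y)) → InjOn Φ W →
      (∀ y : E4, Kerr.rPlus M a + ε / 2 ≤ Kerr.radius a y → Kerr.radius a y ≤ R →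
        Φ y ∈ docOf 𝓢 M a Ψ) →
      HawkingPair 𝓢 M a Ψ K V →
      𝓢.metric.toPseudoRiemannianMetric.IsKillingFieldOn K
        (V ∪ belowZone 𝓢 M a Ψ (rPhPlus M a - ε)) →
      ContDiffOn ℝ ∞ kf (D ∩ {y | Kerr.radius a y < c₁}) →
      (∀ y ∈ D ∩ {y | Kerr.radius a y < c₁}, ∀ Y Z : E4,
        fderiv ℝ (𝓢.metricInCoords Φ) y (kf y) Y Z + 𝓢.metricInCoords Φ y (fderiv ℝ kf y Y) Z +
          𝓢.metricInCoords Φ y Y (fderiv ℝ kf y Z) = 0) →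
      EqOn kf (fun y : E4 => (mfderiv 𝓘(ℝ, E4) (𝓡 4) Φ y).inverse (K (Φ y)))
        (D ∩ {y | Kerr.radius a y < c₀}) →
      ContDiffOn ℝ ∞ kF {y | C * M / 2 < Kerr.radius a y} →
      (∀ y ∈ {y : E4 | C * M / 2 < Kerr.radius a y}, ∀ Y Z : E4,
        fderiv ℝ (𝓢.metricInCoords Φ) y (kF y) Y Z + 𝓢.metricInCoords Φ y (fderiv ℝ kF y Y) Z +
          𝓢.metricInCoords Φ y Y (fderiv ℝ kF y Z) = 0) →
      EqOn kF kf {y | C * M / 2 < Kerr.radius a y ∧ Kerr.radius a y < C * M} →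
      ∃ (K' : Π x : 𝓢.carrier, TangentSpace (𝓡 4) x) (V' : Set 𝓢.carrier),
        HawkingPair 𝓢 M a Ψ K' V' ∧ V' ⊆ V ∧
        𝓢.metric.toPseudoRiemannianMetric.IsKillingFieldOn K' (V' ∪ docOfChart 𝓢 M a Ψ) := by
  intro 𝓢 _ M a ε C c₀ c₁ R Ψ Φ W D K V kf kF hMpos hε hεM hrp2 h16 hR3 hc₀ hc₀gt hc₀CM hCMc₁ hWdef
    hDdef hD hDW hΦΨ hdom hΨe hΦsW hinjW hInjW himg_doc hKV hKK hkfcd hkfeq hkfagree hkFcd hkFeq hkFagree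
  have hltc : ∀ c : ℝ, IsOpen {y : E4 | Kerr.radius a y < c} := fun c ↦
    isOpen_lt (Kerr.continuous_radius a) continuous_const
  have hW₁ : IsOpen (D ∩ {y | Kerr.radius a y < c₁}) := hD.inter (hltc c₁)
  -- glue the swept field (below `C M`) with the far field (beyond `C M / 2`) in the chart
  have hs₁o : IsOpen (D ∩ {y | Kerr.radius a y < C * M}) := hD.inter (hltc _)
  have hs₂o : IsOpen {y : E4 | C * M / 2 < Kerr.radius a y} :=
    isOpen_lt continuous_const (Kerr.continuous_radius a)
  have hs₁sub : D ∩ {y | Kerr.radius a y < C * M} ⊆ D ∩ {y | Kerr.radius a y < c₁} :=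
    fun y hy ↦ ⟨hy.1, lt_trans (show Kerr.radius a y < C * M from hy.2) hCMc₁⟩
  obtain ⟨kG, hkG₁, hkG₂⟩ := coordField_glue _ _ kf kF hs₁o hs₂o
    (show EqOn kf kF ((D ∩ {y | Kerr.radius a y < C * M}) ∩ {y : E4 | C * M / 2 < Kerr.radius a y})
      from fun y hy ↦ (hkFagree ⟨hy.2, hy.1.2⟩).symm)
  obtain ⟨Wg, hWgdef⟩ : ∃ Wg : Set E4,
      Wg = (D ∩ {y | Kerr.radius a y < C * M}) ∪ {y : E4 | C * M / 2 < Kerr.radius a y} := ⟨_, rfl⟩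
  have hWg : IsOpen Wg := by rw [hWgdef]; exact hs₁o.union hs₂o
  have hWgW : Wg ⊆ W := by
    rw [hWgdef]
    rintro y (hy | hy)
    · exact hDW hy.1
    · rw [hWdef]; show M < Kerr.radius a y
      linarith only [show C * M / 2 < Kerr.radius a y from hy, h16, hMpos]
  have hkGcd : ContDiffOn ℝ ∞ kG Wg := by
    rw [hWgdef]
    rintro y (hy | hy)
    · exact (((hkfcd y (hs₁sub hy)).contDiffAt (hW₁.mem_nhds (hs₁sub hy))).congr_of_eventuallyEq
        (hkG₁ y hy)).contDiffWithinAt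
    · exact (((hkFcd y hy).contDiffAt (hs₂o.mem_nhds hy)).congr_of_eventuallyEq
        (hkG₂ y hy)).contDiffWithinAt
  have hkGeq : ∀ y ∈ Wg, ∀ Y Z : E4,
      fderiv ℝ (𝓢.metricInCoords Φ) y (kG y) Y Z + 𝓢.metricInCoords Φ y (fderiv ℝ kG y Y) Z +
        𝓢.metricInCoords Φ y Y (fderiv ℝ kG y Z) = 0 := by
    rw [hWgdef]
    rintro y (hy | hy) Y Z
    · rw [(hkG₁ y hy).fderiv_eq, (hkG₁ y hy).eq_of_nhds]; exact hkfeq y (hs₁sub hy) Y Z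
    · rw [(hkG₂ y hy).fderiv_eq, (hkG₂ y hy).eq_of_nhds]; exact hkFeq y hy Y Z
  -- N-5: the glued field as a manifold Killing field on `Φ '' Wg`
  have hinjWg : InjOn Φ Wg := hInjW.mono hWgW
  obtain ⟨Kp, hKp⟩ : ∃ Kp : Π p : 𝓢.carrier, TangentSpace (𝓡 4) p, Kp = fun p : 𝓢.carrier ↦
      (mfderiv 𝓘(ℝ, E4) (𝓡 4) Φ (Function.invFunOn Φ Wg p)
        (kG (Function.invFunOn Φ Wg p)) : TangentSpace (𝓡 4) p) := ⟨_, rfl⟩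
  have hKpsm := Theorems.stub_contMDiffOn_pushforwardField 𝓢 Φ _ kG hWg (hΦsW.mono hWgW)
    (fun y hy ↦ hinjW y (hWgW hy)) hinjWg hkGcd
  have hKpKil : 𝓢.metric.toPseudoRiemannianMetric.IsKillingFieldOn Kp (Φ '' Wg) := by
    rw [hKp]
    refine ⟨hKpsm, ?_⟩
    rintro _ ⟨y, hy, rfl⟩ Y Z
    have hkd : DifferentiableAt ℝ kG y :=
      ((hkGcd y hy).contDiffAt (hWg.mem_nhds hy)).differentiableAt (by simp)
    exact Theorems.stub_killing_pushforward_at 𝓢 Φ _ kG hWg (hΦsW.mono hWgW)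
      (fun y hy ↦ hinjW y (hWgW hy)) hinjWg hKpsm y hy hkd (hkGeq y hy) Y Z
  -- `Kp = K` on `Φ '' W₀`, `W₀ = D ∩ {r < c₀}`
  have hW₀Wg : D ∩ {y | Kerr.radius a y < c₀} ⊆ D ∩ {y | Kerr.radius a y < C * M} :=
    fun y hy ↦ ⟨hy.1, lt_trans (show Kerr.radius a y < c₀ from hy.2) hc₀CM⟩
  have hKpK : ∀ y ∈ D ∩ {y | Kerr.radius a y < c₀}, Kp (Φ y) = K (Φ y) := by
    intro y hy
    have hys : y ∈ D ∩ {y | Kerr.radius a y < C * M} := hW₀Wg hy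
    have hy1 : y ∈ Wg := by rw [hWgdef]; exact Or.inl hys
    have hinv : (mfderiv 𝓘(ℝ, E4) (𝓡 4) Φ y).IsInvertible :=
      PseudoRiemannianMetric.isInvertible_mfderiv_of_injective (Φ := Φ) rfl (hinjW y (hDW hy.1))
    rw [hKp]
    show mfderiv 𝓘(ℝ, E4) (𝓡 4) Φ (Function.invFunOn Φ Wg (Φ y)) (kG (Function.invFunOn Φ Wg (Φ y))) =
      K (Φ y)
    rw [Literature.Geometry.Manifold.invFunOn_apply hinjWg hy1, (hkG₁ y hys).eq_of_nhds, hkfagree hy]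
    exact hinv.self_apply_inverse _
  -- a chart point of `Φ '' Wg` with radius below `r₊ + 3ε/4` lies in `W₀`
  have hWgW₀ : ∀ y ∈ W, Kerr.radius a y < Kerr.rPlus M a + 3 * ε / 4 →
      Φ y ∈ Φ '' Wg → y ∈ D ∩ {y | Kerr.radius a y < c₀} := by
    rintro y hyW hyr ⟨y₁, hy₁, hyy⟩
    have heq : y₁ = y := hInjW (hWgW hy₁) hyW hyy
    subst heq
    rw [hWgdef] at hy₁
    rcases hy₁ with hy₁ | hy₁
    · exact ⟨hy₁.1, show Kerr.radius a y₁ < c₀ by linarith only [hyr, hc₀gt, hε]⟩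
    · exfalso
      linarith only [show C * M / 2 < Kerr.radius a y₁ from hy₁, hyr, hrp2, hεM, h16, hMpos]
  -- the glued field and the shrunk two-sided neighbourhood
  classical
  obtain ⟨K', hK'⟩ : ∃ K' : Π p : 𝓢.carrier, TangentSpace (𝓡 4) p, K' = fun p : 𝓢.carrier ↦
      if p ∈ Φ '' Wg then Kp p else K p := ⟨_, rfl⟩
  obtain ⟨U', hU'⟩ : ∃ U' : Set E4, U' = {y | M < Kerr.radius a y ∧
      Kerr.radius a y < Kerr.rPlus M a + 3 * ε / 4} := ⟨_, rfl⟩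
  have hU'W : U' ⊆ W := by intro y hy; rw [hU'] at hy; rw [hWdef]; exact hy.1
  have hU'open : IsOpen U' := by
    rw [hU']
    exact (isOpen_lt continuous_const (Kerr.continuous_radius a)).inter
      (isOpen_lt (Kerr.continuous_radius a) continuous_const)
  have hK'K_of : ∀ p : 𝓢.carrier, (p ∈ Φ '' Wg → ∃ y ∈ D ∩ {y | Kerr.radius a y < c₀}, Φ y = p) →
      K' p = K p := by
    intro p hp
    rw [hK']
    by_cases h : p ∈ Φ '' Wg
    · obtain ⟨y, hy, rfl⟩ := hp h
      simp only [h, if_true]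
      exact hKpK y hy
    · simp only [h, if_false]
  have hK'U' : ∀ y ∈ U', K' (Φ y) = K (Φ y) := by
    intro y hy
    refine hK'K_of _ fun h ↦ ⟨y, hWgW₀ y (hU'W hy) (by rw [hU'] at hy; exact hy.2) h, rfl⟩
  -- openness of the node's sets
  have hbij : ∀ U : Set E4, U ⊆ W → IsOpen U → IsOpen (Φ '' U) := fun U hUW hU ↦
    Literature.Geometry.Manifold.isOpen_image_of_bijective_mfderiv hU (hΦsW.mono hUW) fun z hz ↦
      mfderiv_bijective_of_injective (hinjW z (hUW hz)) rfl
  have hdocOpen : IsOpen (docOf 𝓢 M a Ψ) :=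
    𝓢.metric.isOpen_chronologicalPast_of_boundaryless 𝓢.timeOrientation _
  have hbzOpen : ∀ ρ₁ : ℝ, IsOpen (belowZone 𝓢 M a Ψ ρ₁) := by
    intro ρ₁
    refine IsOpen.inter ?_ hdocOpen
    exact hΨe.isOpenMap _ ((hltc ρ₁).preimage continuous_subtype_val)
  -- every chart point beyond `r₊ + ε/2` is in `docOf` (near: §1f; far: the far zone is open, F4)
  have hdoc_all : ∀ x : (starBG M a).domain, Kerr.rPlus M a + ε / 2 ≤ Kerr.radius a x.1 →
      Ψ x ∈ docOf 𝓢 M a Ψ := by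
    intro x hx
    rcases le_or_gt (Kerr.radius a x.1) R with hxR | hxR
    · have h := himg_doc x.1 hx hxR
      rwa [hΦΨ x] at h
    · have hfz : Ψ x ∈ farZone 𝓢 M a Ψ (3 * M) :=
        ⟨x, show 3 * M < Kerr.radius a x.1 by linarith only [hxR, hR3], rfl⟩
      exact Theorems.stub_subset_chronologicalPast_of_isOpen 𝓢 _
        (hΨe.isOpenMap _ ((isOpen_lt continuous_const (Kerr.continuous_radius a)).preimage
          continuous_subtype_val)) hfz
  -- the Hawking pair `(K', V')`
  have hV'open : IsOpen (V ∩ Φ '' U') := hKV.1.inter (hbij U' hU'W hU'open)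
  have hhor : horizonOf 𝓢 M a Ψ ⊆ V ∩ Φ '' U' := by
    intro p hp
    refine ⟨hKV.2.1 hp, ?_⟩
    obtain ⟨hpf, ⟨x, rfl⟩⟩ := hp
    have hxM : M < Kerr.radius a x.1 := by
      have hx := x.2
      have : (x.1 : E4) ∈ ((starBG M a).domain : Set E4) := hx
      rw [← hdom] at this; exact this
    refine ⟨x.1, ?_, hΦΨ x⟩
    rw [hU']
    refine ⟨hxM, ?_⟩
    by_contra hnot
    rw [not_lt] at hnot
    have hdoc : Ψ x ∈ docOf 𝓢 M a Ψ := hdoc_all x (by linarith only [hnot, hε])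
    have hem := hdocOpen.inter_frontier_eq
    have : Ψ x ∈ docOf 𝓢 M a Ψ ∩ frontier (docOf 𝓢 M a Ψ) := ⟨hdoc, hpf⟩
    rw [hem] at this
    exact this
  have hK'V' : ∀ p ∈ V ∩ Φ '' U', K' p = K p := by
    rintro _ ⟨-, ⟨y, hy, rfl⟩⟩
    exact hK'U' y hy
  have hHP : HawkingPair 𝓢 M a Ψ K' (V ∩ Φ '' U') := by
    refine ⟨hV'open, hhor, ?_, fun p hp ↦ ?_⟩
    · exact Theorems.killingLoc_isKillingFieldOn_congr 𝓢 _ K K' hV'open hK'V'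
        (hKV.2.2.1.mono inter_subset_left)
    · rw [hK'V' p (hhor hp)]
      exact hKV.2.2.2 p hp
  -- the Killing property of `K'` on `V' ∪ docOfChart`
  have hO₁ : 𝓢.metric.toPseudoRiemannianMetric.IsKillingFieldOn K' (Φ '' Wg) := by
    refine Theorems.killingLoc_isKillingFieldOn_congr 𝓢 _ Kp K' (hbij _ hWgW hWg) (fun p hp ↦ ?_) hKpKil
    rw [hK']
    simp only [hp, if_true]
  have hO₂open : IsOpen ((V ∩ Φ '' U') ∪ (belowZone 𝓢 M a Ψ c₀ ∩ Φ '' U')) :=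
    hV'open.union ((hbzOpen c₀).inter (hbij U' hU'W hU'open))
  have hO₂ : 𝓢.metric.toPseudoRiemannianMetric.IsKillingFieldOn K'
      ((V ∩ Φ '' U') ∪ (belowZone 𝓢 M a Ψ c₀ ∩ Φ '' U')) := by
    refine Theorems.killingLoc_isKillingFieldOn_congr 𝓢 _ K K' hO₂open (fun p hp ↦ ?_) (hKK.mono ?_)
    · rcases hp with hp | ⟨-, ⟨y, hy, rfl⟩⟩
      · exact hK'V' p hp
      · exact hK'U' y hy
    · refine union_subset_union inter_subset_left ?_
      rw [← hc₀]; exact inter_subset_left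
  have hunion := Theorems.killingLoc_isKillingFieldOn_union 𝓢 _ _ K' (hbij _ hWgW hWg) hO₂open hO₁ hO₂
  refine ⟨K', V ∩ Φ '' U', hHP, inter_subset_left, hunion.mono ?_⟩
  rintro p (hp | hp)
  · exact Or.inr (Or.inl hp)
  · -- `p ∈ docOfChart = docOf ∩ range Ψ`: swept/far chart region, or the near collar below `c₀`
    obtain ⟨hpdoc, ⟨x, rfl⟩⟩ := hp
    have hxM : M < Kerr.radius a x.1 := by
      have : (x.1 : E4) ∈ ((starBG M a).domain : Set E4) := x.2
      rw [← hdom] at this; exact this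
    by_cases hxr : Kerr.rPlus M a + ε / 2 < Kerr.radius a x.1
    · refine Or.inl ⟨x.1, ?_, hΦΨ x⟩
      rw [hWgdef]
      by_cases hxC : Kerr.radius a x.1 < C * M
      · refine Or.inl ⟨?_, hxC⟩
        rw [hDdef]; exact ⟨hxr, by linarith only [hxC, hCMc₁]⟩
      · exact Or.inr (show C * M / 2 < Kerr.radius a x.1 by linarith only [not_lt.mp hxC, h16, hMpos])
    · refine Or.inr (Or.inr ⟨⟨⟨x, ?_, rfl⟩, hpdoc⟩, ⟨x.1, ?_, hΦΨ x⟩⟩)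
      · show Kerr.radius a x.1 < c₀
        linarith only [not_lt.mp hxr, hc₀gt, hε]
      · rw [hU']; exact ⟨hxM, by linarith only [not_lt.mp hxr, hε]⟩

end Summit.FinalStateConjecture.FinalStateConjecture.Theorems.PhotonShellNode

end
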